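import Summits.HodgeConjecture.HodgeConjecture.Theorems.PadicSemiregularLiftHodgeAbelianVarietiesCMPivotConverse
import Summits.HodgeConjecture.HodgeConjecture.Theorems.PadicSemiregularLiftHodgeAbelianVarietiesCMPivotEtalePrimitive
import Summits.HodgeConjecture.HodgeConjecture.Theorems.PadicSemiregularLiftHodgeAbelianVarietiesCMPivotRationalRepresentation
import Summits.HodgeConjecture.HodgeConjecture.Theorems.PadicSemiregularLiftHodgeAbelianVarietiesCMPivotBridgeItems
import HarnessLib

/-!
# Crux `HodgeAbelianVarieties` (stmt-HodgeConjecture-1333), line `cm-pivot` gen 4 — the converse CM-typing bridge, UNCONDITIONAL; child 1 `HodgeCM[]` ⟺ the existing item `CMAbelianHodge` (stmt-3052)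

Route `PadicSemiregularLift`, crux r4 `HodgeAbelianVarieties := ∀ A : AbelianVariety ℂ, HodgeConjectureFor A.dim A.X`.
The line `cm-pivot` decomposes the crux as `HodgeCM[] ∧ (section data) ∧ (local VHC at CM fibres)`; c6's bridge
`cmSubalgebra_of_isCM` made child 1 `HodgeCM[]` (HC for abelian varieties with an endomorphism having `2 · dim A`
distinct eigenvalues on `H¹`) a CONSEQUENCE of the shared item `CMAbelianHodge` (stmt-HodgeConjecture-3052: HC for
abelian varieties whose `End⁰(A)` contains a commutative reduced subalgebra of rank `2 · dim A`). Gen 4 closes the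
circle. The three registered gen-4 stubs have landed:

* `stub_etalePrimitive` (file `…CMPivotEtalePrimitive`, p141407) — primitive element theorem for finite étale `ℚ`-algebras;
* `stub_rationalRepresentation` (file `…CMPivotRationalRepresentation`, p141224) — the faithful rational representation
  `End⁰(A) →ₐ[ℚ] M_{2 dim A}(ℚ)` packaged with a basis of `H¹(A(ℂ); ℂ)`;
* `isCM_of_cmSubalgebra_of_stubs` (file `…CMPivotConverse`, p140966) — the composition, modulo the two statements above.

This file assembles them:

* `stub_isCM_of_cmSubalgebra` — **(∃ S ⊆ End⁰(A) commutative reduced, finrank ℚ S = 2 · dim A) ⟹ IsCM[A]**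
  (registered stub 6 of the gen-4 skeleton, now unconditional);
* `isCM_iff_exists_cmSubalgebra` — **the two CM typings of the tree agree**: `IsCM[A] ⟺ ∃ S ⊆ End⁰(A)` commutative
  reduced of rank `2 · dim A` (Mumford §22 / Shimura–Taniyama §5.1: "`A` admits sufficiently many complex multiplications");
* `hodgeAbelianVarieties_iff_cmAbelianHodge_and_cmToAbelian`, `hodgeAbelianVarieties_iff_hodgeCM_and_cmToAbelian` — **the crux
  ⟺ stmt-3052 ∧ stmt-16267** (⟺ `HodgeCM[] ∧ CMToAbelian`): the decomposition is an equivalence, kernel-checked;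
* `cmAbelianHodge_of_hodgeCM`, `hodgeCM_iff_cmAbelianHodge` — **child 1 of the CM pivot IS the existing item**:
  `HodgeCM[] ⟺ SupersingularIsotypicLift.CMAbelianHodge` (stmt-3052; byte-identical with `RankFourFaces.CMAbelianHodge`,
  `rankFourFaces_cmAbelianHodge_iff`). So the planner's staged split `HodgeAbelianVarieties ⇐ stmt-3052 ∧ stmt-16267`
  (`hodgeAbelianVarieties_of_cmAbelianHodge_of_cmToAbelian`, file `…CMPivotBridgeItems`) loses nothing on child 1.

References: [MumfordAV1970] §19 Thm. 3 and Cor., §22; G. Shimura, Y. Taniyama, *Complex multiplication of abelian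
varieties* (1961) §5.1 Prop. 1–3; [LangeBirkenhake1992] §1.1 Prop. 1.1.6.
-/

set_option linter.dupNamespace false

noncomputable section

open CategoryTheory
open Literature.AlgebraicGeometry Literature.AlgebraicGeometry.Motives

namespace Summit.HodgeConjecture.HodgeConjecture.Theorems.HodgeAbelianVarieties.CMPivot

/-- `IsCM[A]` — CM type in the typing of the `HodgeAbelianVarieties` crux lines (verbatim from
`Cruxes/HodgeAbelianVarieties/Lines/cm_pivot.lean`): an endomorphism with `2 · dim A` distinct eigenvalues on
`H¹(A(ℂ); ℂ)`. Local notation only. -/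
local notation3 (prettyPrint := false) "IsCM[" A "]" =>
  ∃ (ψ : A ⟶ A) (μ : Fin (2 * AbelianVariety.dim A) → ℂ), Function.Injective μ ∧
    ∀ i, Module.End.HasEigenvalue (HodgeTheory.complexBetti.map ψ.hom.hom.hom 1).hom (μ i)

/-- `HodgeCM[]` — CHILD 1 of the CM pivot: the Hodge conjecture for complex abelian varieties of CM type in the
typing `IsCM[A]` (verbatim from `Cruxes/HodgeAbelianVarieties/Lines/cm_pivot.lean`). Local notation only. -/
local notation3 (prettyPrint := false) "HodgeCM[]" =>
  ∀ A : AbelianVariety ℂ, IsCM[A] → HodgeTheory.HodgeConjectureFor A.dim A.X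

/-- **STUB 6 of the gen-4 skeleton, unconditional — the converse CM-typing bridge**: if `End⁰(A) = ℚ ⊗ End A`
contains a commutative reduced `ℚ`-subalgebra of dimension `2 · dim A`, then some endomorphism of `A` has `2 · dim A`
distinct eigenvalues on `H¹(A(ℂ); ℂ)`. Assembly of the three landed gen-4 pieces (`isCM_of_cmSubalgebra_of_stubs` fed
with `stub_etalePrimitive` and `stub_rationalRepresentation`). [cite: MumfordAV1970, §19 Thm. 3 and §22] -/
theorem stub_isCM_of_cmSubalgebra :
    ∀ A : AbelianVariety ℂ,
      (∃ S : Subalgebra ℚ A.endAlgebra, IsReduced ↥S ∧ (∀ x ∈ S, ∀ y ∈ S, x * y = y * x) ∧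
        Module.finrank ℚ ↥S = 2 * A.dim) → IsCM[A] :=
  isCM_of_cmSubalgebra_of_stubs (fun S hred hcomm hfin => stub_etalePrimitive S hred hcomm hfin)
    stub_rationalRepresentation

/-- **The two CM typings of the tree agree**: a complex abelian variety has an endomorphism with `2 · dim A`
distinct eigenvalues on `H¹(A(ℂ); ℂ)` iff `End⁰(A)` contains a commutative reduced `ℚ`-subalgebra of dimension
`2 · dim A` (c6's `cmSubalgebra_of_isCM` and `stub_isCM_of_cmSubalgebra`). [cite: MumfordAV1970, §22 (CM type)] -/
theorem isCM_iff_exists_cmSubalgebra (A : AbelianVariety ℂ) :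
    IsCM[A] ↔
      ∃ S : Subalgebra ℚ A.endAlgebra, IsReduced ↥S ∧ (∀ x ∈ S, ∀ y ∈ S, x * y = y * x) ∧
        Module.finrank ℚ ↥S = 2 * A.dim :=
  ⟨cmSubalgebra_of_isCM A, stub_isCM_of_cmSubalgebra A⟩

/-- **Child 1 ⟹ stmt-3052**: HC for abelian varieties of CM type in the eigenvalue typing (`HodgeCM[]`) implies
the shared item `SupersingularIsotypicLift.CMAbelianHodge` (stmt-HodgeConjecture-3052), by the converse bridge.
[cite: MumfordAV1970, §22 (CM type)] -/
theorem cmAbelianHodge_of_hodgeCM :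
    HodgeCM[] → Summit.HodgeConjecture.HodgeConjecture.Theses.SupersingularIsotypicLift.CMAbelianHodge :=
  fun h A _ hS => h A (stub_isCM_of_cmSubalgebra A hS)

/-- **Child 1 of the CM pivot IS the existing item stmt-3052**: `HodgeCM[] ⟺ CMAbelianHodge`
(`hodgeCM_of_cmAbelianHodge` of `…CMPivotBridgeItems` and `cmAbelianHodge_of_hodgeCM`). Hence the staged split
`HodgeAbelianVarieties ⇐ stmt-3052 ∧ stmt-16267` loses nothing on its first child. [cite: MumfordAV1970, §22 (CM type)] -/
theorem hodgeCM_iff_cmAbelianHodge :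
    HodgeCM[] ↔ Summit.HodgeConjecture.HodgeConjecture.Theses.SupersingularIsotypicLift.CMAbelianHodge :=
  ⟨cmAbelianHodge_of_hodgeCM, hodgeCM_of_cmAbelianHodge⟩

/-- **The crux is EQUIVALENT to the conjunction of the two existing items** stmt-3052 (`CMAbelianHodge`, HC for CM
abelian varieties) and stmt-16267 (`CMToAbelian`, HC(CM) ⟹ HC for all abelian varieties): the decomposition carried by
the line `cm-pivot` is lossless (`hodgeAbelianVarieties_of_cmAbelianHodge_of_cmToAbelian`, `cmToAbelian_of_hodgeAbelianVarieties`
of `…CMPivotBridgeItems`, and the trivial `crux ⟹ stmt-3052`). [folklore] -/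
theorem hodgeAbelianVarieties_iff_cmAbelianHodge_and_cmToAbelian :
    Summit.HodgeConjecture.HodgeConjecture.Theses.PadicSemiregularLift.HodgeAbelianVarieties ↔
      (Summit.HodgeConjecture.HodgeConjecture.Theses.RankFourFaces.CMAbelianHodge ∧
        Summit.HodgeConjecture.HodgeConjecture.Theses.RankFourFaces.CMToAbelian) :=
  ⟨fun h => ⟨fun A _ _ => h A, cmToAbelian_of_hodgeAbelianVarieties h⟩,
    fun h => hodgeAbelianVarieties_of_cmAbelianHodge_of_cmToAbelian h.1 h.2⟩

/-- **… and, in the line's own typing, to `HodgeCM[] ∧ CMToAbelian`** (child 1 in the eigenvalue typing; by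
`hodgeCM_iff_cmAbelianHodge` and `rankFourFaces_cmAbelianHodge_iff`). [folklore] -/
theorem hodgeAbelianVarieties_iff_hodgeCM_and_cmToAbelian :
    Summit.HodgeConjecture.HodgeConjecture.Theses.PadicSemiregularLift.HodgeAbelianVarieties ↔
      (HodgeCM[] ∧ Summit.HodgeConjecture.HodgeConjecture.Theses.RankFourFaces.CMToAbelian) :=
  hodgeAbelianVarieties_iff_cmAbelianHodge_and_cmToAbelian.trans
    (and_congr_left' (rankFourFaces_cmAbelianHodge_iff.trans hodgeCM_iff_cmAbelianHodge.symm))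

end Summit.HodgeConjecture.HodgeConjecture.Theorems.HodgeAbelianVarieties.CMPivot

end
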